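import Summits.QuantumAdvantage.QuantumAdvantage.Theorems.CharDialSubRankB

/-! # CharDialSubRankC — part 3/4 (mechanical split for landing of `CharDialSubRank`; content verbatim; scopes re-opened with their variables) -/

noncomputable section
open Finset
open Summit.QuantumAdvantage.AdviceFreeQNC0 Summit.QuantumAdvantage.AdviceFreeQNC0.JLinPeel

namespace Summit.QuantumAdvantage.AdviceFreeQNC0.WindowCounter
open Summit.QuantumAdvantage.AdviceFreeQNC0 AffBells23

section FormJuntaG
variable (p : ℕ) [Fact p.Prime]

/-- the generalised form-twisted win sum `Σ_u [WIN^{gen}_y u] ψ_p(t ⟨a,u⟩)`. -/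
def formSumG {n m : ℕ} (pat κ : Fin m → ℕ) (a : Fin n → ZMod p) (y : Fin m → (Fin n → Bool) → Bool)
    (t : ZMod p) : ℂ :=
  ∑ u : Fin n → Bool, (if ringWinGen pat κ y u = true then (1 : ℂ) else 0) * (ZMod.stdAddChar (t * linF p a u) : ℂ)

/-- **THE FORM-TWISTED BIAS OF JUNTA STRATEGIES IN A GENERALISED-BELL GAME (p ≥ 5)**: `m` bells at arbitrary positions
with arbitrary phases, `L`-junta tables, a dense direction `a`, `t ≠ 0`, and `Q·(m(L+1)² + n) ≤ n²`, `Q ≤ n` ⟹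
`‖Σ_u [WIN u] ψ_p(t⟨a,u⟩)‖ ≤ ε·2ⁿ`. -/
theorem formJunta_smallG (hp : 5 ≤ p) : ∀ ε : ℝ, 0 < ε → ∃ Q : ℕ, ∀ (n m L : ℕ) (pat κ : Fin m → ℕ)
    (a : Fin n → ZMod p) (y : Fin m → (Fin n → Bool) → Bool),
      (∀ b, ∃ J : Finset (Fin n), J.card ≤ L ∧ ∀ u v : Fin n → Bool, (∀ i ∈ J, u i = v i) → y b u = y b v) →
      Q * (m * (L + 1) ^ 2 + n) ≤ n ^ 2 → Q ≤ n → n ≤ 2 * (univ.filter fun i : Fin n => a i ≠ 0).card →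
        ∀ t : ZMod p, t ≠ 0 → ‖formSumG p pat κ a y t‖ ≤ ε * 2 ^ n := by
  classical
  intro ε hε
  have hκ0 := kappaF_nonneg p
  have hκ1 := kappaF_lt_one p hp
  obtain ⟨q₀, hq₀⟩ := exists_pow_lt_of_lt_one hε hκ1
  refine ⟨576 * q₀ + 16, fun n m L pat κ a y hy hQ hQn hdense t ht => ?_⟩
  have hn16 : 16 ≤ n := by omega
  choose J hJc hJ using hy
  -- candidate starts: good positions with room for a block
  set S₀ : Finset ℕ := (range n).filter fun k => k + 3 ≤ n ∧ aExt p a k ≠ 0 with hS₀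
  have hS₀card : (univ.filter fun i : Fin n => a i ≠ 0).card ≤ S₀.card + 2 := by
    have h1 : ((univ.filter fun i : Fin n => a i ≠ 0 ∧ i.val + 3 ≤ n).image fun i : Fin n => i.val) ⊆ S₀ := by
      intro k hk; rw [mem_image] at hk; obtain ⟨i, hi, rfl⟩ := hk; rw [mem_filter] at hi
      rw [hS₀, mem_filter, mem_range]; refine ⟨i.isLt, hi.2.2, ?_⟩
      unfold aExt; rw [dif_pos i.isLt]; exact hi.2.1
    have h2 : (univ.filter fun i : Fin n => ¬ (i.val + 3 ≤ n)).card ≤ 2 := by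
      calc _ ≤ (range 2).card := Finset.card_le_card_of_injOn (fun i : Fin n => n - 1 - i.val) (fun i hi => by
              have hi' : ¬ (i.val + 3 ≤ n) := by simpa using hi
              simp only [mem_coe, mem_range]; omega) (by
              intro i hi i' hi' hh
              have h3 : ¬ (i.val + 3 ≤ n) := by simpa using hi
              have h4 : ¬ (i'.val + 3 ≤ n) := by simpa using hi'
              ext; simp only at hh; omega)
        _ = 2 := card_range 2
    have h3 := card_le_card h1
    rw [card_image_of_injective _ Fin.val_injective] at h3
    calc (univ.filter fun i : Fin n => a i ≠ 0).card
        ≤ ((univ.filter fun i : Fin n => a i ≠ 0 ∧ i.val + 3 ≤ n) ∪ (univ.filter fun i : Fin n => ¬ (i.val + 3 ≤ n))).card :=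
          card_le_card (by
            intro i hi; rw [mem_filter] at hi; rw [mem_union, mem_filter, mem_filter]
            by_cases h : i.val + 3 ≤ n
            · exact Or.inl ⟨hi.1, hi.2, h⟩
            · exact Or.inr ⟨hi.1, h⟩)
      _ ≤ _ := card_union_le _ _
      _ ≤ S₀.card + 2 := add_le_add h3 h2
  obtain ⟨r, -, hr⟩ := Finset.exists_le_card_fiber_of_mul_le_card_of_maps_to (s := S₀) (t := range 3) (f := fun k => k % 3)
    (fun k _ => mem_range.2 (Nat.mod_lt _ (by norm_num))) (by simp) (by rw [card_range]; exact Nat.mul_div_le _ 3)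
  set T := S₀.filter fun k => k % 3 = r with hTdef
  have hT3 : S₀.card ≤ 3 * T.card + 2 := by have := hr; omega
  have hTn : ∀ k ∈ T, k + 3 ≤ n := fun k hk => by
    have := (mem_filter.1 (mem_filter.1 hk).1).2; exact this.1
  have hTgd : ∀ k ∈ T, aExt p a k ≠ 0 := fun k hk => by
    have := (mem_filter.1 (mem_filter.1 hk).1).2; exact this.2
  have hTsep : ∀ k ∈ T, ∀ k' ∈ T, k ≠ k' → k + 3 ≤ k' ∨ k' + 3 ≤ k := fun k hk k' hk' hne => by
    have h1 := (mem_filter.1 hk).2; have h2 := (mem_filter.1 hk').2; omega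
  have hTle : T.card ≤ n :=
    (card_le_card (filter_subset _ _)).trans ((card_le_card (filter_subset _ _)).trans (card_range n).le)
  obtain ⟨M, k, hkT, hkinj, hni, hsize⟩ := exists_blocksG pat J hJc T hTsep
  -- enough blocks
  have hM : q₀ ≤ M := by
    by_contra hlt; push Not at hlt
    have h12 : n ≤ 12 * T.card := by omega
    have hsz : T.card ^ 2 ≤ 2 * q₀ * (2 * (m * (L + 1) ^ 2) + T.card) :=
      le_trans hsize (Nat.mul_le_mul_right _ (Nat.mul_le_mul_left _ hlt.le))
    have h4 : 2 * q₀ * (2 * (m * (L + 1) ^ 2) + T.card) ≤ 576 * q₀ * (m * (L + 1) ^ 2 + n) := by nlinarith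
    have h5 : n ^ 2 ≤ 144 * T.card ^ 2 := by nlinarith
    have h6 : (576 * q₀ + 16) * (m * (L + 1) ^ 2 + n) ≤ n ^ 2 := hQ
    nlinarith
  -- the two character sums
  have hkn : ∀ j, k j + 3 ≤ n := fun j => hTn _ (hkT j)
  have hksep : ∀ j j', j ≠ j' → k j + 3 ≤ k j' ∨ k j' + 3 ≤ k j := fun j j' h => hTsep _ (hkT j) _ (hkT j') (hkinj j j' h)
  have hkgd : ∀ j, aExt p a (k j) ≠ 0 := fun j => hTgd _ (hkT j)
  have hQ1 := norm_sum_QfG_le p pat κ y J hp hJ a ht M k hkn hksep hni hkgd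
  have hQ0 := norm_sum_QfG_le p pat κ (fun _ _ => false) J hp (fun _ _ _ _ => rfl) a ht M k hkn hksep hni hkgd
  have hplain : ∑ u, QfG p pat κ (fun _ _ => false) a t u = ∑ u : Fin n → Bool, (ZMod.stdAddChar (t * linF p a u) : ℂ) :=
    sum_congr rfl fun u _ => by simp [QfG, firesG]
  rw [hplain] at hQ0
  have e : ∀ u : Fin n → Bool, (if ringWinGen pat κ y u = true then (1 : ℂ) else 0) * (ZMod.stdAddChar (t * linF p a u) : ℂ) =
      ((ZMod.stdAddChar (t * linF p a u) : ℂ) - QfG p pat κ y a t u) / 2 := fun u => by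
    rw [win_indicatorG]; unfold QfG; ring
  have hform : formSumG p pat κ a y t =
      ((∑ u : Fin n → Bool, (ZMod.stdAddChar (t * linF p a u) : ℂ)) - ∑ u, QfG p pat κ y a t u) / 2 := by
    unfold formSumG; rw [sum_congr rfl fun u _ => e u, ← sum_div, sum_sub_distrib]
  have hκM : kappaF p ^ M ≤ kappaF p ^ q₀ := pow_le_pow_of_le_one hκ0 hκ1.le hM
  have h2 : ‖(2 : ℂ)‖ = 2 := by simp
  have h2n : (0 : ℝ) ≤ 2 ^ n := by positivity
  rw [hform, norm_div, h2]
  calc _ ≤ (‖∑ u : Fin n → Bool, (ZMod.stdAddChar (t * linF p a u) : ℂ)‖ + ‖∑ u, QfG p pat κ y a t u‖) / 2 := by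
        gcongr; exact norm_sub_le _ _
    _ ≤ (2 ^ n * kappaF p ^ M + 2 ^ n * kappaF p ^ M) / 2 := by gcongr
    _ = 2 ^ n * kappaF p ^ M := by ring
    _ ≤ 2 ^ n * kappaF p ^ q₀ := mul_le_mul_of_nonneg_left hκM h2n
    _ ≤ ε * 2 ^ n := by rw [mul_comm]; exact mul_le_mul_of_nonneg_right hq₀.le h2n

end FormJuntaG

end Summit.QuantumAdvantage.AdviceFreeQNC0.WindowCounter


/-! # §24 THE `r`-FORM DIAL OF A GENERALISED-BELL GAME and its Fourier reduction over `(ℤ/p)^r`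

§J verbatim for `ringWinGen`: the generalised `r`-form dial `formStratRG`, the class count over `(ℤ/p)^r`
(`class_count_le_formRG`), the main term from the TREE's `AffBells23.walkHardGen` (ONE `θ₀` for every number of
bells, all positions, all phases; `(log₂ N)²`-juntas have `𝔽₂`-degree `≤ (log₂ N)²`, `C = 2`), the error terms from
`formJunta_smallG`; result `form_reductionRG`: ONE rate `θ₁ = (1+θ₀)/2 < 1` for EVERY rank `r`, every bell budget
`m ≤ K·N`, every well-spread direction family — the uniformity in `r` is what the rank induction of §25 needs. -/

namespace Summit.QuantumAdvantage.AdviceFreeQNC0.WindowCounter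

open Summit.QuantumAdvantage.AdviceFreeQNC0 AffBells23

section SpreadFormG

variable (p : ℕ) [Fact p.Prime] {n : ℕ}

/-- the generalised `r`-form dial: consult the class vector, then play the class strategy. -/
def formStratRG {r m : ℕ} (A : Fin r → Fin n → ZMod p) (Y : (Fin r → ZMod p) → Fin m → (Fin n → Bool) → Bool) :
    Fin m → (Fin n → Bool) → Bool := fun b u => Y (vecF p A u) b u

/-- `ringWinGen pat κ y u` depends on `y` only through the answers at `u`. -/
theorem ringWinGen_congr {m : ℕ} {pat κ : Fin m → ℕ} {y y' : Fin m → (Fin n → Bool) → Bool} {u : Fin n → Bool}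
    (h : ∀ b, y b u = y' b u) : ringWinGen pat κ y u = ringWinGen pat κ y' u := by
  unfold ringWinGen
  simp only [h]

/-- CharDialSubRankC helper `card_win_formRG_eq_sum` (decomp-qadv land package; see the module docstring). -/
theorem card_win_formRG_eq_sum {m : ℕ} (pat κ : Fin m → ℕ) {r : ℕ} (A : Fin r → Fin n → ZMod p)
    (Y : (Fin r → ZMod p) → Fin m → (Fin n → Bool) → Bool) :
    #{u : Fin n → Bool | ringWinGen pat κ (formStratRG p A Y) u = true} =
      ∑ s : Fin r → ZMod p, #{u : Fin n → Bool | ringWinGen pat κ (Y s) u = true ∧ vecF p A u = s} := by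
  rw [card_eq_sum_card_fiberwise (f := fun u : Fin n → Bool => vecF p A u) (t := univ) fun u _ => mem_univ _]
  refine sum_congr rfl fun s _ => ?_
  rw [filter_filter]
  congr 1
  refine filter_congr fun u _ => ?_
  refine ⟨fun h => ⟨?_, h.2⟩, fun h => ⟨?_, h.2⟩⟩
  · rw [← h.1]; symm
    exact ringWinGen_congr fun b => by simp only [formStratRG, h.2]
  · rw [← h.1]
    exact ringWinGen_congr fun b => by simp only [formStratRG, h.2]

/-- the class bound over `(ℤ/p)^r` for the generalised game. -/
theorem class_count_le_formRG {m : ℕ} (pat κ : Fin m → ℕ) {r : ℕ} (A : Fin r → Fin n → ZMod p)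
    (y : Fin m → (Fin n → Bool) → Bool) (s : Fin r → ZMod p) :
    (p : ℝ) ^ r * #{u : Fin n → Bool | ringWinGen pat κ y u = true ∧ vecF p A u = s} ≤
      #{u : Fin n → Bool | ringWinGen pat κ y u = true} +
        ∑ t ∈ univ.erase (0 : Fin r → ZMod p), ‖formSumG p pat κ (comb p t A) y 1‖ := by
  have hid : ((p : ℂ) ^ r) * ((#{u : Fin n → Bool | ringWinGen pat κ y u = true ∧ vecF p A u = s} : ℕ) : ℂ) =
      ∑ t : Fin r → ZMod p, ZMod.stdAddChar (-(∑ j, t j * s j)) * formSumG p pat κ (comb p t A) y 1 := by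
    have e1 : ((#{u : Fin n → Bool | ringWinGen pat κ y u = true ∧ vecF p A u = s} : ℕ) : ℂ) =
        ∑ u : Fin n → Bool, (if ringWinGen pat κ y u = true then (1 : ℂ) else 0) *
          (if vecF p A u - s = 0 then (1 : ℂ) else 0) := by
      rw [← sum_boole]
      refine sum_congr rfl fun u _ => ?_
      by_cases h1 : vecF p A u = s <;> by_cases h2 : ringWinGen pat κ y u = true <;> simp [h1, h2, sub_eq_zero]
    rw [e1, mul_sum]
    have e2 : ∀ u : Fin n → Bool, ((p : ℂ) ^ r) * ((if ringWinGen pat κ y u = true then (1 : ℂ) else 0) *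
        (if vecF p A u - s = 0 then (1 : ℂ) else 0)) =
        ∑ t : Fin r → ZMod p, ZMod.stdAddChar (-(∑ j, t j * s j)) *
          ((if ringWinGen pat κ y u = true then (1 : ℂ) else 0) * (ZMod.stdAddChar (1 * linF p (comb p t A) u) : ℂ)) := by
      intro u
      have h := ite_eq_sum_charR p (vecF p A u - s)
      rw [show (if vecF p A u - s = 0 then ((p : ℂ) ^ r) else 0) =
          ((p : ℂ) ^ r) * (if vecF p A u - s = 0 then 1 else 0) by rw [mul_ite, mul_one, mul_zero]] at h
      rw [mul_left_comm, h, mul_sum]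
      refine sum_congr rfl fun t _ => ?_
      have e3 : ∑ j, t j * (vecF p A u - s) j = 1 * linF p (comb p t A) u + -(∑ j, t j * s j) := by
        rw [one_mul, linF_comb, ← sub_eq_add_neg, ← sum_sub_distrib]
        refine sum_congr rfl fun j _ => ?_
        rw [Pi.sub_apply, mul_sub]; rfl
      rw [e3, AddChar.map_add_eq_mul]
      ring
    simp only [e2]
    rw [sum_comm]
    refine sum_congr rfl fun t _ => ?_
    rw [formSumG, mul_sum]
  have hA0 : formSumG p pat κ (comb p 0 A) y 1 = (#{u : Fin n → Bool | ringWinGen pat κ y u = true} : ℂ) := by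
    rw [formSumG]
    have : ∀ u : Fin n → Bool, linF p (comb p 0 A) u = 0 := fun u => by simp [linF, comb]
    simp only [this, mul_zero, AddChar.map_zero_eq_one, mul_one]
    rw [sum_boole]
  have hnorm : (p : ℝ) ^ r * #{u : Fin n → Bool | ringWinGen pat κ y u = true ∧ vecF p A u = s} ≤
      ∑ t : Fin r → ZMod p, ‖formSumG p pat κ (comb p t A) y 1‖ := by
    have : (p : ℝ) ^ r * #{u : Fin n → Bool | ringWinGen pat κ y u = true ∧ vecF p A u = s} =
        ‖((p : ℂ) ^ r) * ((#{u : Fin n → Bool | ringWinGen pat κ y u = true ∧ vecF p A u = s} : ℕ) : ℂ)‖ := by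
      rw [norm_mul, norm_pow, Complex.norm_natCast, Complex.norm_natCast]
    rw [this, hid]
    refine le_trans (norm_sum_le _ _) (sum_le_sum fun t _ => ?_)
    rw [norm_mul, norm_char, one_mul]
  rw [← add_sum_erase univ (fun t => ‖formSumG p pat κ (comb p t A) y 1‖) (mem_univ (0 : Fin r → ZMod p)), hA0] at hnorm
  simpa only [Complex.norm_natCast] using hnorm

/-- `log₂ n ≤ (log₂ N)²` once `n ≤ K·N` and `N` is large. -/
theorem log_le_sq_log (K : ℕ) : ∃ N₁ : ℕ, ∀ N ≥ N₁, ∀ n ≤ K * N, Nat.log 2 n ≤ (Nat.log 2 N) ^ 2 := by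
  refine ⟨max K 8, fun N hN n hn => ?_⟩
  have hK : K ≤ N := le_trans (le_max_left _ _) hN
  have h8 : 8 ≤ N := le_trans (le_max_right _ _) hN
  have h3 : 3 ≤ Nat.log 2 N := Nat.le_log_of_pow_le one_lt_two (by norm_num; omega)
  have hnN : n ≤ N * N := hn.trans (Nat.mul_le_mul_right _ hK)
  have hlt : N * N < 2 ^ (2 * (Nat.log 2 N + 1)) := by
    have := Nat.lt_pow_succ_log_self one_lt_two N
    rw [pow_mul, pow_two] at *
    calc N * N < 2 ^ (Nat.log 2 N + 1) * 2 ^ (Nat.log 2 N + 1) := Nat.mul_lt_mul'' this this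
      _ = (2 ^ 2) ^ (Nat.log 2 N + 1) := by rw [← mul_pow]; norm_num
  have h1 : Nat.log 2 n < 2 * (Nat.log 2 N + 1) := by
    rcases Nat.eq_zero_or_pos n with rfl | hn0
    · simp
    · exact Nat.log_lt_of_lt_pow hn0.ne' (lt_of_le_of_lt hnN hlt)
  nlinarith

/-- **THE MAIN TERM, FROM THE TREE**: `(log₂ N)²`-junta strategies of a generalised-bell game lose (`AffBells23.walkHardGen`,
`C = 2`; one `θ₀` for all `m`, `pat`, `κ`). -/
theorem genMain : ∃ θ₀ : ℝ, θ₀ < 1 ∧ ∃ N₀ : ℕ, ∀ N ≥ N₀, ∀ (m : ℕ) (pat κ : Fin m → ℕ)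
    (y : Fin m → (Fin N → Bool) → Bool),
    (∀ b, ∃ J : Finset (Fin N), J.card ≤ (Nat.log 2 N) ^ 2 ∧ ∀ u v : Fin N → Bool, (∀ i ∈ J, u i = v i) →
      y b u = y b v) →
      (#{u : Fin N → Bool | ringWinGen pat κ y u = true} : ℝ) ≤ θ₀ * 2 ^ N := by
  obtain ⟨θ, hθ, hC⟩ := walkHardGen
  obtain ⟨n₀, hn₀⟩ := hC 2
  exact ⟨θ, hθ, n₀, fun N hN m pat κ y hy => hn₀ N hN m pat κ y fun b => by
    obtain ⟨J, hJ, hdep⟩ := hy b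
    exact BlockFibre37.hasDeg_of_dependsOn J hJ hdep⟩

/-- **GENERALISED `r`-FORM-DIAL FOURIER REDUCTION — ONE RATE FOR EVERY RANK**: for `p ≥ 5` there is `θ₁ < 1` such that
for every `r`, `K`: eventually in `N`, every generalised-bell game with `m ≤ K·N` bells and every `r`-form dial of
`(log₂ N)²`-junta class strategies over WELL-SPREAD directions (every nonzero combination dense) wins on `≤ θ₁·2^N`. -/
theorem form_reductionRG (hp : 5 ≤ p) : ∃ θ₁ : ℝ, θ₁ < 1 ∧ ∀ r K : ℕ, ∃ N₀ : ℕ, ∀ N ≥ N₀, ∀ m ≤ K * N,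
    ∀ (pat κ : Fin m → ℕ) (A : Fin r → Fin N → ZMod p) (Y : (Fin r → ZMod p) → Fin m → (Fin N → Bool) → Bool),
      (∀ t : Fin r → ZMod p, t ≠ 0 → N ≤ 2 * (univ.filter fun i : Fin N => comb p t A i ≠ 0).card) →
      (∀ s b, ∃ J : Finset (Fin N), J.card ≤ (Nat.log 2 N) ^ 2 ∧ ∀ u v : Fin N → Bool, (∀ i ∈ J, u i = v i) →
        Y s b u = Y s b v) →
        (#{u : Fin N → Bool | ringWinGen pat κ (formStratRG p A Y) u = true} : ℝ) ≤ θ₁ * 2 ^ N := by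
  obtain ⟨θ₀, hθ₀, N₀, hN₀⟩ := genMain
  have hp0 : (0 : ℝ) < p := by exact_mod_cast (Fact.out : p.Prime).pos
  set ε : ℝ := (1 - θ₀) / 2 with hε
  have hε0 : 0 < ε := by rw [hε]; linarith
  refine ⟨θ₀ + ε, by rw [hε]; linarith, fun r K => ?_⟩
  have hpr : (0 : ℝ) < (p : ℝ) ^ r := by positivity
  obtain ⟨Q, hQ⟩ := formJunta_smallG p hp (ε / p ^ r) (by positivity)
  obtain ⟨N₁, hN₁⟩ := DWalk.const_mul_logPow_le' (Q * (4 * K + 1)) 4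
  refine ⟨max (max N₀ N₁) 2, fun N hN m hm pat κ A Y hdense hY => ?_⟩
  have hNN₀ : N₀ ≤ N := le_trans (le_trans (le_max_left _ _) (le_max_left _ _)) hN
  have hNN₁ : N₁ ≤ N := le_trans (le_trans (le_max_right _ _) (le_max_left _ _)) hN
  have hN2 : 2 ≤ N := le_trans (le_max_right _ _) hN
  set ℓ := Nat.log 2 N with hℓdef
  have hℓ : 1 ≤ ℓ := Nat.le_log_of_pow_le one_lt_two (by rw [pow_one]; exact hN2)
  have hB := hN₁ N hNN₁
  have hℓ4 : 1 ≤ ℓ ^ 4 := Nat.one_le_pow _ _ hℓ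
  have hQn : Q ≤ N := by
    calc Q = Q * 1 * 1 := by ring
      _ ≤ Q * (4 * K + 1) * ℓ ^ 4 := Nat.mul_le_mul (Nat.mul_le_mul_left _ (by omega)) hℓ4
      _ ≤ N := hB
  have hL1 : (ℓ ^ 2 + 1) ^ 2 ≤ 4 * ℓ ^ 4 := by nlinarith [hℓ]
  have hQN : Q * (m * (ℓ ^ 2 + 1) ^ 2 + N) ≤ N ^ 2 := by
    calc Q * (m * (ℓ ^ 2 + 1) ^ 2 + N) ≤ Q * (K * N * (4 * ℓ ^ 4) + N * ℓ ^ 4) :=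
          Nat.mul_le_mul_left _ (add_le_add (Nat.mul_le_mul hm hL1) (by
            calc N = N * 1 := (mul_one _).symm
              _ ≤ N * ℓ ^ 4 := Nat.mul_le_mul_left _ hℓ4))
      _ = N * (Q * (4 * K + 1) * ℓ ^ 4) := by ring
      _ ≤ N * N := Nat.mul_le_mul_left _ hB
      _ = N ^ 2 := (sq N).symm
  have hcardT : ((univ.erase (0 : Fin r → ZMod p)).card : ℝ) ≤ (p : ℝ) ^ r := by
    have : (univ.erase (0 : Fin r → ZMod p)).card ≤ p ^ r :=
      le_trans (card_erase_le) (by rw [card_univ, Fintype.card_fun, ZMod.card, Fintype.card_fin])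
    exact_mod_cast this
  have hcls : ∀ s : Fin r → ZMod p,
      (p : ℝ) ^ r * #{u : Fin N → Bool | ringWinGen pat κ (Y s) u = true ∧ vecF p A u = s} ≤ θ₀ * 2 ^ N + ε * 2 ^ N := by
    intro s
    refine le_trans (class_count_le_formRG p pat κ A (Y s) s) (add_le_add (hN₀ N hNN₀ m pat κ _ (hY s)) ?_)
    calc ∑ t ∈ univ.erase (0 : Fin r → ZMod p), ‖formSumG p pat κ (comb p t A) (Y s) 1‖
        ≤ ∑ t ∈ univ.erase (0 : Fin r → ZMod p), ε / p ^ r * 2 ^ N :=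
          sum_le_sum fun t ht => hQ N m (ℓ ^ 2) pat κ (comb p t A) (Y s) (hY s) hQN hQn
            (hdense t (ne_of_mem_erase ht)) 1 one_ne_zero
      _ ≤ (p : ℝ) ^ r * (ε / p ^ r * 2 ^ N) := by
          rw [sum_const, nsmul_eq_mul]
          exact mul_le_mul_of_nonneg_right hcardT (by positivity)
      _ = ε * 2 ^ N := by field_simp
  have hsum : (p : ℝ) ^ r * #{u : Fin N → Bool | ringWinGen pat κ (formStratRG p A Y) u = true} ≤
      (p : ℝ) ^ r * (θ₀ * 2 ^ N + ε * 2 ^ N) := by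
    rw [card_win_formRG_eq_sum p pat κ A Y]
    push_cast
    rw [mul_sum]
    calc _ ≤ ∑ s : Fin r → ZMod p, (θ₀ * 2 ^ N + ε * 2 ^ N) := sum_le_sum fun s _ => hcls s
      _ = (p : ℝ) ^ r * (θ₀ * 2 ^ N + ε * 2 ^ N) := by
          rw [sum_const, card_univ, Fintype.card_fun, ZMod.card, Fintype.card_fin, nsmul_eq_mul]; push_cast; ring
  have := le_of_mul_le_mul_left hsum hpr
  linarith

end SpreadFormG

end Summit.QuantumAdvantage.AdviceFreeQNC0.WindowCounter
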